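import Literature.MathematicalPhysics.QuantumFieldTheory.Balaban1983to89.Node00.TkWeightsOfRecordP
import Literature.MathematicalPhysics.QuantumFieldTheory.Balaban1983to89.Node00.Sect2FormOfRecord

/-!
# DAG node N11 — 11a's `𝐓_n(s)` OF RECORD READS ITS OPERAND ONLY ON THE «READING SUPPORT»: the top scale fixed, every lower scale `j < n` charged by a
# non-zero generation weight `ζ_j(Ω^c_{j+1})` — hence, under 12a″'s displayed law `RegOn`, regular on the reading regions

HEADER — WORK-UNIT METADATA.  Cell `pub-ymgap`, YM-PLAN Track A (HUMAN RULING D-0062), seat `pub-ymgap-dag-n11-d` (g11; R134 fan-out seat N11 [B14], strategy s2),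
route `BalabanUVNodes`, item K1⁷ `StabilityBAtRecordR13SepCoPH` = stmt-QuantumFields-20542 (helper, `--kind proof --supports 20542 --as helper`, count-neutral).
[III] = [Balaban1988Convergent].  Over 11a (`Node00.TkOfRecord`: `genOp`, `tkBranchOfRecord`, `TkOfRecord`, `baseCfg`), 11c (`sect2Slot`), 12a″ (`Node00.TkWeightsOfRecordP`:
`tkWeightsOfRecordP`, the displayed law `TkResidualW.RegOn`).

WHY THIS FILE.  Door (d4) of this seat (the space truncation of the §2 witness, `…N11SpaceTruncationDefs`) changes the term values OFF the analyticity loci;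
to conclude that the §2 SLOT is unchanged one needs to know WHERE 11a's operation reads its operand.  (2.20)–(2.21): `𝐓_n(s) = 𝐓^{(n−1)} ⋯ 𝐓^{(0)}`, each
`𝐓^{(j)}Φ(ω) = ∫dy ζ_j(ω_y) ∫da w_j(ω_{y,a}) Φ(ω_{y,a})` — a generation reads `Φ` only at configurations charged by BOTH its weights (`genOp_congr_supp`, pointwise,
transport-generic, no laws); descending through the generations from the base configuration `base_n(V_n)` (scale `n` fixed at `V_n`, never updated since every
generation `j < n` updates scale `j` only), the operand is read only at configurations `ω` with `(ω n).1 = V_n` and, for every `j < n`, a non-zero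
`ζ_j(Ω^c_{j+1})` at a configuration with the same scale-`j` gauge component (`tkBranchOfRecord_congr_of_descending`, an abstract descending invariant).  With
12a″'s displayed law `RegOn Γr` of the residual («a non-zero `ζ0_j(Y)` forces `(cR·ε_j)`-regularity of the retained scale-`j` variables on the reading region
`Γr j Y`», discharged by whoever pins the residual), the invariant «scales `≥ i` regular on their reading regions, top = `V_n`» descends: ★★ `TkOfRecord_congr_on_read`.

WHAT THIS FILE PROVES (0 `sorry`, 0 `def`).
* §1 `genOp_congr_supp` — ONE GENERATION READS ITS OPERAND ONLY WHERE `ζ ≠ 0` AND `w ≠ 0` (pointwise in the outer configuration; any restricted transport).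
* §2 ★ `tkBranchOfRecord_congr_of_descending` — for any predicate family `Good i` on configurations that DESCENDS through generation `i` (from `Good (i+1) ω`
  to `Good i (ω with scale i updated)` whenever the generation-`i` weights charge the update), two operands agreeing on `Good 0` have the same branch images
  `𝐓_i(s,S)` on `Good i`.
* §3 ★★ `tkBranchOfRecord_congr_on_read` ∕ `TkOfRecord_congr_on_read` — with `Reg j` := any property of the scale-`j` gauge variables FORCED by a non-zero
  `ζ_j(Ω^c_{j+1}(s))` (hypothesis `hζ`), two operands of r11's shape agreeing at every `({S_i}, A, 𝐖)` with `𝐖 n = V_n` and `Reg j (𝐖 j)` for all `j < n` have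
  the same `𝐓_n(s)`-image at `V_n`; `sect2Slot_congr_on_read` (the §2 slot reads the operand there only); ★★ `TkOfRecord_congr_on_read_of_regOn` — at 12a″'s
  weights `tkWeightsOfRecordP … Z` under `Z.RegOn Γr`: `Reg j U := PlaqSmallOn (plaqsOf (pts j (Γr j (Ω_{j+1})ᶜ))) (cR·ε_j) U`.

HONEST FRAMING.  Helper lane of K1⁷; kernel bookkeeping of (2.20)–(2.21) (where an integral operator with multiplicative weights reads its integrand); nothing of
Bałaban's is asserted; 12a″'s `RegOn` is a HYPOTHESIS.  N11 NOT discharged; K1⁷ NOT closed; counts unmoved (typed 28∕28 · discharged 5∕27).  One finite four-torus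
programme at fixed `ε = L^{−K}` — NOT ℝ⁴, NOT OS, NOT a mass gap, NOT Clay.  No `sorry`, `axiom`, `def`, `instance`, `notation`.
Sources (SHAPE only): [III] (2.18) p.257, (2.20)–(2.21) p.258, (2.10) p.256, (2.2) p.255, (3.24) p.270.
-/

noncomputable section

open MeasureTheory
open scoped BigOperators

universe u

namespace Summit.QuantumFields.YangMills.Theorems.BalabanUVNodesN11TkReadingSupport

open Literature.MathematicalPhysics.QuantumFieldTheory.Balaban1983to89 T4Continuum Node00 Node00.Tk
open B15DeterminingSets B8Eq17ClassAkV1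
open T4AdjointCovariance (JCfg insA)

/-! ## §1  One generation reads its operand only where both its weights are non-zero -/

section Gen

variable {P : Params} {G : Type u} {V : Type u}
variable [NormedAddCommGroup V] [InnerProductSpace ℝ V] [FiniteDimensional ℝ V] [MeasurableSpace V] [BorelSpace V]

/-- **ONE GENERATION `𝐓^{(j)}` READS ITS OPERAND ONLY WHERE `ζ_j ≠ 0` AND `w_j ≠ 0`**: if `F ω″ = F′ ω″` at every configuration `ω″ = ω_{y,a}` (scale-`j` gauge
variables on `sV` replaced by `y`, fluctuation variables on `sA` inserted) with `ζ(ω_y) ≠ 0` and `w(ω_{y,a}) ≠ 0`, then `𝐓^{(j)}F ω = 𝐓^{(j)}F′ ω` — for ANY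
restricted transport (the two functions of `y` handed to it coincide). [cite: Balaban1988Convergent, (2.21) p.258] -/
theorem genOp_congr_supp {j : ℕ} {hdec : DecidableEq (PBond P j)} (D : GenData P G V j) {F F' : MultiCfg P G V → ℝ} (ω : MultiCfg P G V)
    (h : ∀ (y : ↥D.sV → G) (a : ↥D.sA → V),
      D.ζ (Function.update ω j (Function.updateFinset (ω j).1 D.sV y, (ω j).2)) ≠ 0 →
      D.w (Function.update (Function.update ω j (Function.updateFinset (ω j).1 D.sV y, (ω j).2)) j
          (insA D.sA a ((Function.update ω j (Function.updateFinset (ω j).1 D.sV y, (ω j).2)) j))) ≠ 0 →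
      F (Function.update (Function.update ω j (Function.updateFinset (ω j).1 D.sV y, (ω j).2)) j
          (insA D.sA a ((Function.update ω j (Function.updateFinset (ω j).1 D.sV y, (ω j).2)) j))) =
      F' (Function.update (Function.update ω j (Function.updateFinset (ω j).1 D.sV y, (ω j).2)) j
          (insA D.sA a ((Function.update ω j (Function.updateFinset (ω j).1 D.sV y, (ω j).2)) j)))) :
    genOp j D F ω = genOp j D F' ω := by
  simp only [genOp_apply, vOp_apply]
  congr 1
  funext y
  simp only [zetaOp_apply]
  by_cases hζ : D.ζ (Function.update ω j (Function.updateFinset (ω j).1 D.sV y, (ω j).2)) = 0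
  · rw [hζ, zero_mul, zero_mul]
  · congr 1
    rw [aOp_apply, aOp_apply]
    refine integral_congr_ae (Filter.Eventually.of_forall fun a => ?_)
    by_cases hw : D.w (Function.update (Function.update ω j (Function.updateFinset (ω j).1 D.sV y, (ω j).2)) j
        (insA D.sA a ((Function.update ω j (Function.updateFinset (ω j).1 D.sV y, (ω j).2)) j))) = 0
    · show D.w _ * F _ = D.w _ * F' _
      rw [hw, zero_mul, zero_mul]
    · show D.w _ * F _ = D.w _ * F' _
      rw [h y a hζ hw]

end Gen

/-! ## §2  The branch operator of record: congruence along a descending invariant -/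

section Branch

variable {F : T4Family} {N : ℕ} [NeZero N] {V : Type} [NormedAddCommGroup V] [InnerProductSpace ℝ V] [FiniteDimensional ℝ V] [MeasurableSpace V] [BorelSpace V]
variable (ν : Stage7Numerics) (M : ℕ) (g : ℕ → ℝ) (K : ℕ) (W : TkWeights F N V K)

/-- **★ CONGRUENCE OF `𝐓_i(s, S)` ALONG A DESCENDING INVARIANT.**  Let `Good i` be predicates on the all-scales configuration such that, whenever `Good (i+1) ω`
holds and the generation-`i` weights charge a scale-`i` update of `ω` — `ζ_i(Ω^c_{i+1})` non-zero at an update `ω[i ↦ c₀]`, `w_i` non-zero at the update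
`ω[i ↦ c]`, with the same gauge component `c₀.1 = c.1` — `Good i (ω[i ↦ c])` holds.  Then two operands agreeing on `Good 0` have the same images under
`𝐓_i(s, S)` at every configuration satisfying `Good i`. [cite: Balaban1988Convergent, (2.20)–(2.21) p.258, (3.24) p.270] -/
theorem tkBranchOfRecord_congr_of_descending {n : ℕ} (s : SeqOfRecord F ν M g K n) (S : ℕ → Set (Site (F.P K) 0))
    (Good : ℕ → MultiCfg (F.P K) (SU N) V → Prop)
    (hstep : ∀ (i : ℕ) (ω : MultiCfg (F.P K) (SU N) V) (c₀ c : JCfg (F.P K) i (SU N) V), Good (i + 1) ω → c₀.1 = c.1 →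
      W.ζ i (s.Ω (i + 1))ᶜ (Function.update ω i c₀) ≠ 0 →
      W.w i (s.Λ (i + 1)) ((s.Λ (i + 1))ᶜ ∩ s.Ω (i + 1)) (S (i + 1)) (Function.update ω i c) ≠ 0 → Good i (Function.update ω i c))
    {Φ Φ' : MultiCfg (F.P K) (SU N) V → ℝ} (h0 : ∀ ω, Good 0 ω → Φ ω = Φ' ω) :
    ∀ (i : ℕ) (ω : MultiCfg (F.P K) (SU N) V), Good i ω → tkBranchOfRecord F N V ν M g K W s S i Φ ω = tkBranchOfRecord F N V ν M g K W s S i Φ' ω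
  | 0, ω, hω => h0 ω hω
  | i + 1, ω, hω => by
      rw [tkBranchOfRecord_succ, tkBranchOfRecord_succ]
      refine genOp_congr_supp _ ω fun y a hζ hw => ?_
      rw [Function.update_idem] at hw ⊢
      refine tkBranchOfRecord_congr_of_descending s S Good hstep h0 i _ (hstep i ω _ _ hω ?_ hζ hw)
      rw [Function.update_self]
      rfl

end Branch

/-! ## §3  `𝐓_n(s)` of record reads its operand only on the reading support -/

section Read

variable {F : T4Family} {N : ℕ} [NeZero N] {V : Type} [NormedAddCommGroup V] [InnerProductSpace ℝ V] [FiniteDimensional ℝ V] [MeasurableSpace V] [BorelSpace V]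
variable (ν : Stage7Numerics) (M : ℕ) (g : ℕ → ℝ) (K : ℕ) (W : TkWeights F N V K)

omit [NeZero N] [InnerProductSpace ℝ V] [FiniteDimensional ℝ V] [MeasurableSpace V] [BorelSpace V] in
/-- The top scale of the base configuration is the argument. [cite: Balaban1988Convergent, (2.18) p.257 (bookkeeping)] -/
theorem baseCfg_top_fst (n : ℕ) (Vn : GaugeField (F.P K) n (SU N)) : ((baseCfg (V := V) n Vn) n).1 = Vn := by
  funext b
  show (if h : n = n then Vn (h ▸ b) else 1) = Vn b
  rw [dif_pos rfl]

/-- **★★ `𝐓_n(s, S)` READS ITS OPERAND ONLY ON THE READING SUPPORT** (branch form): let `Reg j` be any property of the scale-`j` gauge variables forced by a non-zero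
generation-`j` weight `ζ_j(Ω^c_{j+1}(s))` (`hζ`); two operands agreeing at every configuration whose top scale is `V_n` and whose scales `j < n` satisfy `Reg j`
have the same image under `𝐓_n(s, S)` at the base configuration of `V_n`. [cite: Balaban1988Convergent, (2.18) p.257, (2.20)–(2.21) p.258, (2.10) p.256] -/
theorem tkBranchOfRecord_congr_on_read {n : ℕ} (s : SeqOfRecord F ν M g K n) (S : ℕ → Set (Site (F.P K) 0))
    (Reg : (j : ℕ) → GaugeField (F.P K) j (SU N) → Prop)
    (hζ : ∀ j, j < n → ∀ ω : MultiCfg (F.P K) (SU N) V, W.ζ j (s.Ω (j + 1))ᶜ ω ≠ 0 → Reg j (ω j).1)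
    {Φ Φ' : MultiCfg (F.P K) (SU N) V → ℝ} (Vn : GaugeField (F.P K) n (SU N))
    (hΦ : ∀ ω : MultiCfg (F.P K) (SU N) V, (ω n).1 = Vn → (∀ j, j < n → Reg j (ω j).1) → Φ ω = Φ' ω) :
    tkBranchOfRecord F N V ν M g K W s S n Φ (baseCfg n Vn) = tkBranchOfRecord F N V ν M g K W s S n Φ' (baseCfg n Vn) := by
  refine tkBranchOfRecord_congr_of_descending ν M g K W s S
    (fun i ω => i ≤ n ∧ (ω n).1 = Vn ∧ ∀ j, i ≤ j → j < n → Reg j (ω j).1) (fun i ω c₀ c hω hc hz _ => ?_)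
    (fun ω hω => hΦ ω hω.2.1 fun j hj => hω.2.2 j (Nat.zero_le j) hj) n (baseCfg n Vn) ⟨le_rfl, baseCfg_top_fst K n Vn, fun j hj hjn => absurd hjn (not_lt.mpr hj)⟩
  obtain ⟨hi, htop, hreg⟩ := hω
  have hin : i < n := hi
  refine ⟨hin.le, ?_, fun j hij hjn => ?_⟩
  · rw [Function.update_of_ne (Nat.ne_of_gt hin)]; exact htop
  · rcases Nat.eq_or_lt_of_le hij with rfl | hlt
    · rw [Function.update_self, ← hc]
      have h1 := hζ i hjn _ hz
      rwa [Function.update_self] at h1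
    · rw [Function.update_of_ne (Nat.ne_of_gt hlt)]
      exact hreg j hlt hjn

/-- **★★ `𝐓_n(s)` OF RECORD READS ITS OPERAND ONLY ON THE READING SUPPORT** (r11's slot shape): two operands agreeing at every `({S_i}, A, 𝐖)` with `𝐖 n = V_n` and
`Reg j (𝐖 j)` for all `j < n` have the same `𝐓_n(s)`-image at `V_n`. [cite: Balaban1988Convergent, (2.18) p.257, (2.20)–(2.21) p.258, (2.10) p.256] -/
theorem TkOfRecord_congr_on_read {n : ℕ} (s : SeqOfRecord F ν M g K n) (Reg : (j : ℕ) → GaugeField (F.P K) j (SU N) → Prop)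
    (hζ : ∀ j, j < n → ∀ ω : MultiCfg (F.P K) (SU N) V, W.ζ j (s.Ω (j + 1))ᶜ ω ≠ 0 → Reg j (ω j).1)
    {Φ Φ' : SFluct (F.P K) V → MSField (F.P K) (SU N) → ℝ} (Vn : GaugeField (F.P K) n (SU N))
    (hΦ : ∀ (S : ℕ → Set (Site (F.P K) 0)) (a : MSFluct (F.P K) V) (U : MSField (F.P K) (SU N)), U n = Vn → (∀ j, j < n → Reg j (U j)) →
      Φ (S, a) U = Φ' (S, a) U) :
    TkOfRecord F N V ν M g K W n s Φ Vn = TkOfRecord F N V ν M g K W n s Φ' Vn := by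
  rw [TkOfRecord_apply, TkOfRecord_apply]
  refine Finset.sum_congr rfl fun S _ => ?_
  exact tkBranchOfRecord_congr_on_read ν M g K W s S Reg hζ Vn fun ω hω hR => hΦ S _ _ hω hR

variable {𝔸 : Type*} [NormedRing 𝔸] [NormedAlgebra ℂ 𝔸] [CompleteSpace 𝔸]

/-- **THE §2 SLOT READS ITS OPERAND ONLY ON THE READING SUPPORT**: two term-value ∕ background data whose operands `exp A_n(s)` agree at every `({S_i}, A, 𝐖)`
of the reading support of `V_n` give the same slot value at `V_n`. [cite: Balaban1988Convergent, (2.18) p.257, (2.23) p.258, (2.20)–(2.21) p.258] -/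
theorem sect2Slot_congr_on_read (Sg : Sect2.Setting 𝔸 (SU N)) (Rz : Sect2.Residual (F.P K) 𝔸) {n : ℕ} (s : SeqOfRecord F ν M g K n)
    (Reg : (j : ℕ) → GaugeField (F.P K) j (SU N) → Prop)
    (hζ : ∀ j, j < n → ∀ ω : MultiCfg (F.P K) (SU N) V, W.ζ j (s.Ω (j + 1))ᶜ ω ≠ 0 → Reg j (ω j).1)
    (t t' : Sect2.TermValues (F.P K) 𝔸 V M) (Ek Ek' : ℝ) (U U' : BgMap F N K) (Vn : GaugeField (F.P K) n (SU N))
    (hΦ : ∀ (a : SFluct (F.P K) V) (Wc : MSField (F.P K) (SU N)), Wc n = Vn → (∀ j, j < n → Reg j (Wc j)) →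
      sect2Operand F N V K Sg Rz s t Ek U a Wc = sect2Operand F N V K Sg Rz s t' Ek' U' a Wc) :
    sect2Slot F N V K Sg Rz W s t Ek U Vn = sect2Slot F N V K Sg Rz W s t' Ek' U' Vn :=
  TkOfRecord_congr_on_read ν M g K W s Reg hζ Vn fun S a Wc hW hR => hΦ (S, a) Wc hW hR

end Read

/-! ## §4  At 12a″'s weights under the displayed law `RegOn`: the reading support is regular on the reading regions -/

section RegOn

variable {F : T4Family} {N : ℕ} [NeZero N] {V : Type} [NormedAddCommGroup V] [InnerProductSpace ℝ V] [FiniteDimensional ℝ V] [MeasurableSpace V] [BorelSpace V]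
variable {ν : Stage7Numerics} {A₁ cR : ℝ} {p : B12.RunParams} {g : ℕ → ℝ} (M : ℕ)

/-- **★★ AT 12a″'s WEIGHTS UNDER `RegOn Γr`, `𝐓_n(s)` READS ITS OPERAND ONLY AT CONFIGURATIONS REGULAR ON THE READING REGIONS**: two operands agreeing at every
`({S_i}, A, 𝐖)` with `𝐖 n = V_n` and `|𝐖_j(∂q) − 1| < cR·ε_j` on the plaquettes touching `Γr j (Ω^c_{j+1}(s))`, `j < n`, have the same `𝐓_n(s)`-image at `V_n`.
[cite: Balaban1988Convergent, (2.10) p.256, (2.18) p.257, (2.20)–(2.21) p.258, (1.11) p.248] -/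
theorem TkOfRecord_congr_on_read_of_regOn {Γr : ℕ → Set (Site (F.P p.K) 0) → Set (Site (F.P p.K) 0)} {Z : TkResidualW F N V p.K}
    (hZ : Z.RegOn F N V ν cR p g Γr) {n : ℕ} (s : SeqOfRecord F ν M g p.K n)
    {Φ Φ' : SFluct (F.P p.K) V → MSField (F.P p.K) (SU N) → ℝ} (Vn : GaugeField (F.P p.K) n (SU N))
    (hΦ : ∀ (S : ℕ → Set (Site (F.P p.K) 0)) (a : MSFluct (F.P p.K) V) (U : MSField (F.P p.K) (SU N)), U n = Vn →
      (∀ j, j < n → PlaqSmallOn (plaqsOf (pts j (Γr j (s.Ω (j + 1))ᶜ))) (cR * epsOfRecord ν g j) (U j)) → Φ (S, a) U = Φ' (S, a) U) :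
    TkOfRecord F N V ν M g p.K (tkWeightsOfRecordP F N V ν A₁ p g Z) n s Φ Vn =
      TkOfRecord F N V ν M g p.K (tkWeightsOfRecordP F N V ν A₁ p g Z) n s Φ' Vn :=
  TkOfRecord_congr_on_read ν M g p.K _ s (fun j U => PlaqSmallOn (plaqsOf (pts j (Γr j (s.Ω (j + 1))ᶜ))) (cR * epsOfRecord ν g j) U)
    (fun j _ _ h => plaqSmallOn_readOn_of_zetaP_ne_zero hZ s.Ω j h) Vn hΦ

variable {𝔸 : Type*} [NormedRing 𝔸] [NormedAlgebra ℂ 𝔸] [CompleteSpace 𝔸]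

/-- **THE §2 SLOT AT 12a″'s WEIGHTS UNDER `RegOn Γr` READS ITS OPERAND ONLY AT CONFIGURATIONS REGULAR ON THE READING REGIONS.**
[cite: Balaban1988Convergent, (2.10) p.256, (2.18) p.257, (2.23) p.258, (2.20)–(2.21) p.258] -/
theorem sect2Slot_congr_on_read_of_regOn (Sg : Sect2.Setting 𝔸 (SU N)) (Rz : Sect2.Residual (F.P p.K) 𝔸)
    {Γr : ℕ → Set (Site (F.P p.K) 0) → Set (Site (F.P p.K) 0)} {Z : TkResidualW F N V p.K} (hZ : Z.RegOn F N V ν cR p g Γr) {n : ℕ}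
    (s : SeqOfRecord F ν M g p.K n) (t t' : Sect2.TermValues (F.P p.K) 𝔸 V M) (Ek Ek' : ℝ) (U U' : BgMap F N p.K) (Vn : GaugeField (F.P p.K) n (SU N))
    (hΦ : ∀ (a : SFluct (F.P p.K) V) (Wc : MSField (F.P p.K) (SU N)), Wc n = Vn →
      (∀ j, j < n → PlaqSmallOn (plaqsOf (pts j (Γr j (s.Ω (j + 1))ᶜ))) (cR * epsOfRecord ν g j) (Wc j)) →
      sect2Operand F N V p.K Sg Rz s t Ek U a Wc = sect2Operand F N V p.K Sg Rz s t' Ek' U' a Wc) :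
    sect2Slot F N V p.K Sg Rz (tkWeightsOfRecordP F N V ν A₁ p g Z) s t Ek U Vn = sect2Slot F N V p.K Sg Rz (tkWeightsOfRecordP F N V ν A₁ p g Z) s t' Ek' U' Vn :=
  TkOfRecord_congr_on_read_of_regOn M hZ s Vn fun S a Wc hW hR => hΦ (S, a) Wc hW hR

end RegOn

end Summit.QuantumFields.YangMills.Theorems.BalabanUVNodesN11TkReadingSupport

end
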